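import Mathlib
import Summits.Ventures.HodgeRepro.LitRank
import Summits.Ventures.HodgeRepro.LitRankRestrict
import Summits.Ventures.HodgeRepro.LitRankYanai
import Summits.Ventures.HodgeRepro.LitRankRibet

/-!
# LitRankDodson — Dodson's bound: a simple CM-type of dimension `d` has rank `≥ 2q` for every odd prime `q` with `q² ∣ d`

Blind cell `pub-hodge-repro`, seat lit-2 (gen 3).  Companion of `LitRank.lean` (same seat); uses
`LitRankRestrict` (rank through right translates, `indFun`), `LitRankYanai` (the quotient by
`normalCore H`) and `LitRankRibet` (the right-translation operator `rt`, the span `V` of the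
conjugates, the norm operator `normOp`, faithfulness).  Mathlib only — no character formula.

**Source.** B. Dodson, *On the Mumford–Tate group of an abelian variety with complex
multiplication*, J. Algebra 111 (1987) 49–73 (store `paper:doi-10-1016-0021-8693-87-90242-0`),
Theorem 1.12, p.54 (store p0006:L40–46): "Let q be an odd prime for which q² divides n.  Then
B(n) ≥ 2q."  Proof p.54–55 (store p0006:L47–51, p0007:L1–42): "We consider the necessary
modifications of the proof of the above Theorem 1.4.  Since q² divides n and q is a prime,
Gal(K^c/Q) has a subgroup of order q²."  Typed in `LitRank.lean` as the named fact
`Dodson1987_theorem1_12`; discharged here (`Dodson1987_theorem1_12_holds`).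

**Architecture (Dodson p.54–55), mirrored.**
1. Sylow: a subgroup `A` of order `q²` (`Sylow.exists_subgroup_card_pow_prime`), after the
   reduction to the faithful quotient `G / normalCore H` (`LitRankYanai.quotientTriple`; Dodson's
   `Gal(K^c/Q)` acts faithfully on the orbit of `Φ` by the Theorem 1.4 observation).
2. "First, we dispose of the case where there is an element x of order q².  Since x^q must have
   nontrivial action on the orbit of types … Examining the ring Q[X]/(X^{q²} − 1), we obtain a
   submodule of dimension q(q − 1) corresponding to the cyclotomic field generated by a primitive
   root of unity ζ_{q²}" (p0007:L4–9): `two_mul_le_rank_of_orderOf_sq` — `w = v − x^q v ≠ 0` is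
   killed by `Φ_{q²}(rt x) = N_{x^q}` (`aeval_rt_cyclotomic_sq`), and Bezout with the irreducible
   `Φ_{q²}` of degree `q(q−1)` (`linearIndependent_pow_apply_of_cyclotomic'`) gives `q(q−1) ≥ 2q`
   independent vectors.
3. "Next, we consider an elementary Abelian subgroup of order q², with generators g and h … if
   there is an element in the span of the orbit of types for which x has trivial action, but y has
   nontrivial action, then we obtain our bound … the trivial submodule for the action of ⟨x⟩ has
   dimension at least 2 + (q − 1), while x has nontrivial action, so there is a complementary
   subspace of dimension at least (q − 1) and our rank is then at least 2q" (p0007:L10–18):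
   `two_mul_le_rank_of_moved` (case (i): `V ⊇ V₀ ⊕ W₂ ⊕ W₁` with `V₀ = span{N_h N_g 𝟙_{S̃}, 𝟙_G}`
   fixed by `g, h` (`exists_fixed_two`, Dodson's coefficient count with `q²` odd), `W₂ ⊆ Fix(g) ∩
   ker N_h` from a `g`-fixed vector moved by `h`, `W₁ ⊆ ker N_g` from faithfulness of `g`).
4. "Now we claim that the above always holds … we consider the elements N_{⟨h⟩}(Φ), N_{⟨gh⟩}(Φ), …,
   N_{⟨g^{q−1}h⟩}(Φ) … We add these q equations together, and observe that the terms may be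
   rearranged" (p0007:L19–42): `two_mul_le_rank_of_not_moved` (case (ii)) — made into an
   idempotent argument on `K = V ∩ ker N_g`: the operators `M_j = N_{g^j h}` satisfy
   `Σ_j M_j = q + (N_h − 1) N_g` (`sum_normOp_pow_mul`, the rearrangement of Dodson's q equations)
   and `M_j M_{j'} = N_g M_{j'}` for `j ≠ j'` (`normOp_pow_mul_mul`), so they are orthogonal
   idempotents (up to `q`) summing to `q` on `K`; if only one `M_{j₀}` were nonzero on `K`, then
   `g^{j₀} h` would fix `K` and (by the case hypothesis) `Fix(g) ∩ V`, hence all of `V` — Dodson's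
   "g(Φ) = Φ, which contradicts our choice of Φ" (p0007:L42); two nonzero `M_j, M_{j'}` give two
   independent `(q−1)`-dimensional pieces inside `ker N_g` (Bezout with `Φ_q`), plus `V₀`.
5. Assembly `two_mul_le_rank_of_core`; the discharge `Dodson1987_theorem1_12_holds`.

No new named fact is introduced (D-0026); every intermediate result is proved inline.

SPLIT NOTE (gen 4): this is part 1 of 3 of the former single file `LitRankDodson.lean` (split at the ≤ 400-line rule; text of every declaration unchanged); the later parts are `LitRankDodson2`, `LitRankDodson`.
-/

open Finset Polynomial
open scoped Pointwise

namespace HodgeRepro.Lit2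

/-! ## §2, §3  Bezout for `Φ_n`; commutation and reindexing; the odd coefficient count -/

/-! ### Bezout for an arbitrary cyclotomic polynomial -/

/-- If `Φ_n(φ) w = 0` and `w ≠ 0` (`n ≥ 1`), then `w, φ w, …, φ^{φ(n)−1} w` are linearly independent
(`Φ_n` is irreducible over `ℚ` of degree `φ(n) = Nat.totient n`). -/
theorem linearIndependent_pow_apply_of_cyclotomic' {M : Type*} [AddCommGroup M] [Module ℚ M]
    (φ : Module.End ℚ M) (n : ℕ) (hn : 0 < n) {w : M} (hw : w ≠ 0)
    (hN : aeval φ (cyclotomic n ℚ) w = 0) :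
    LinearIndependent ℚ (fun k : Fin (Nat.totient n) => (φ ^ (k : ℕ)) w) := by
  rw [Fintype.linearIndependent_iff]
  intro a ha
  by_contra hak
  obtain ⟨k, hk⟩ := not_forall.mp hak
  set c : ℚ[X] := ∑ j : Fin (Nat.totient n), C (a j) * X ^ (j : ℕ) with hc
  have hcw : aeval φ c w = 0 := by
    rw [hc, map_sum, LinearMap.sum_apply]
    rw [← ha]
    refine Finset.sum_congr rfl fun j _ => ?_
    rw [map_mul, aeval_C, aeval_X_pow, Module.End.mul_apply, Module.algebraMap_end_apply]
  have hcoeff : c.coeff (k : ℕ) = a k := by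
    rw [hc, finsetSum_coeff]
    simp only [coeff_C_mul_X_pow]
    rw [Finset.sum_eq_single k]
    · simp
    · intro j _ hjk
      rw [if_neg]
      intro h
      exact hjk (Fin.ext h.symm)
    · intro h; exact absurd (Finset.mem_univ k) h
  have hc0 : c ≠ 0 := fun h => hk (by rw [← hcoeff, h, coeff_zero])
  have hdeg : c.natDegree < Nat.totient n := by
    have htot : 0 < Nat.totient n := Nat.totient_pos.mpr hn
    have : c.natDegree ≤ Nat.totient n - 1 := by
      rw [hc]
      refine natDegree_sum_le_of_forall_le _ _ fun j _ => ?_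
      refine (natDegree_C_mul_X_pow_le _ _).trans ?_
      have := j.isLt
      omega
    omega
  have hdegΦ : (cyclotomic n ℚ).natDegree = Nat.totient n := natDegree_cyclotomic n ℚ
  have hndvd : ¬ cyclotomic n ℚ ∣ c := by
    intro hdvd
    have := natDegree_le_of_dvd hdvd hc0
    omega
  have hcop : IsCoprime (cyclotomic n ℚ) c :=
    (cyclotomic.irreducible_rat hn).coprime_iff_not_dvd.mpr hndvd
  obtain ⟨u, v, huv⟩ := hcop
  have h1 := congrArg (aeval φ) huv
  rw [map_add, map_mul, map_mul, map_one] at h1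
  have h2 := congrArg (fun e : Module.End ℚ M => e w) h1
  simp only [LinearMap.add_apply, Module.End.mul_apply, Module.End.one_apply, hN, hcw, map_zero,
    add_zero] at h2
  exact hw h2.symm

namespace CMTriple

/-! ### Commutation and reindexing for `rt` and `normOp` -/

section Ops

variable {G : Type*} [Group G]

/-- `rt 1 = 1` in `Module.End`. -/
theorem rt_one' : rt (1 : G) = (1 : Module.End ℚ (G → ℚ)) := rt_one

/-- `rt a` and `rt b` commute when `a` and `b` do. -/
theorem rt_comm_of_comm {a b : G} (h : a * b = b * a) : rt a * rt b = rt b * rt a := by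
  rw [Module.End.mul_eq_comp, Module.End.mul_eq_comp, rt_comp, rt_comp, h]

/-- `rt a` commutes with `N_y` when `a` commutes with `y`. -/
theorem rt_comm_normOp {a y : G} (h : a * y = y * a) (q : ℕ) :
    rt a * normOp y q = normOp y q * rt a := by
  unfold normOp
  rw [Finset.mul_sum, Finset.sum_mul]
  refine Finset.sum_congr rfl fun k _ => ?_
  exact rt_comm_of_comm ((Commute.pow_right h k))

/-- `rt (y^k) * N_y = N_y` when `y^q = 1`. -/
theorem rt_pow_mul_normOp (y : G) (q : ℕ) (hy : y ^ q = 1) (k : ℕ) :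
    rt (y ^ k) * normOp y q = normOp y q := by
  induction k with
  | zero => rw [pow_zero, rt_one]; rfl
  | succ n ih => rw [← rt_pow, pow_succ, rt_pow, mul_assoc, rt_mul_normOp y q hy, ih]

/-- `N_y * N_y = q • N_y` when `y^q = 1`. -/
theorem normOp_mul_normOp (y : G) (q : ℕ) (hy : y ^ q = 1) :
    normOp y q * normOp y q = (q : ℚ) • normOp y q := by
  rw [show normOp y q * normOp y q = (∑ k ∈ range q, rt (y ^ k)) * normOp y q from rfl,
    Finset.sum_mul]
  simp only [rt_pow_mul_normOp y q hy, Finset.sum_const, Finset.card_range]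
  exact (Nat.cast_smul_eq_nsmul ℚ q _).symm

/-- `N_y` as a sum over `Fin q`. -/
theorem normOp_eq_sum_fin (y : G) (q : ℕ) : normOp y q = ∑ k : Fin q, rt (y ^ (k : ℕ)) := by
  unfold normOp
  rw [Finset.sum_range]

/-- **Reindexing**: for `y` of prime order `q` and `q ∤ m`, `Σ_{a<q} rt (y^{m a}) = N_y`. -/
theorem sum_rt_pow_mul_eq_normOp {y : G} {q : ℕ} (hq : q.Prime) (hy : orderOf y = q) {m : ℕ}
    (hm : ¬ q ∣ m) : ∑ a : Fin q, rt (y ^ (m * (a : ℕ))) = normOp y q := by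
  rw [normOp_eq_sum_fin]
  have hq0 : 0 < q := hq.pos
  let e : Fin q → Fin q := fun a => ⟨(m * (a : ℕ)) % q, Nat.mod_lt _ hq0⟩
  have he : Function.Bijective e := by
    rw [← Finite.injective_iff_bijective]
    intro a b hab
    have h : (m * (a : ℕ)) % q = (m * (b : ℕ)) % q := congrArg Fin.val hab
    have hmod : (a : ℕ) ≡ (b : ℕ) [MOD q] :=
      Nat.ModEq.cancel_left_of_coprime ((Nat.Coprime.gcd_eq_one (hq.coprime_iff_not_dvd.mpr hm)))
        h
    have hab' : (a : ℕ) = b := by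
      have := hmod
      rwa [Nat.ModEq, Nat.mod_eq_of_lt a.isLt, Nat.mod_eq_of_lt b.isLt] at this
    exact Fin.ext hab'
  refine Fintype.sum_bijective e he _ _ fun a => ?_
  show rt (y ^ (m * (a : ℕ))) = rt (y ^ ((m * (a : ℕ)) % q))
  have h := pow_mod_orderOf y (m * (a : ℕ))
  rw [hy] at h
  rw [h]

end Ops

/-! ### Independence of `(Σ_{i∈s} rt (f i)) 𝟙_{S̃}` and `𝟙_G` for `|s|` odd -/

section Indep

variable {G : Type*} [Group G] [Fintype G] [DecidableEq G] (T : CMTriple G)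

omit [Fintype G] in
/-- The value at `y` of `(Σ_{i∈s} rt (f i)) 𝟙_{S̃}` is the number of `i ∈ s` with `y (f i)⁻¹ ∈ S̃`. -/
theorem sumRt_indFun_apply {ι : Type*} (s : Finset ι) (f : ι → G) (y : G) :
    (∑ i ∈ s, rt (f i)) (indFun T.S) y = ((s.filter fun i => y * (f i)⁻¹ ∈ T.S).card : ℚ) := by
  simp [LinearMap.sum_apply, rt_apply, indFun]

/-- `Σ_y (Σ_{i∈s} rt (f i)) 𝟙_{S̃} (y) = |s| · |S̃|`. -/
theorem sum_sumRt_indFun {ι : Type*} (s : Finset ι) (f : ι → G) :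
    ∑ y : G, (∑ i ∈ s, rt (f i)) (indFun T.S) y = (s.card : ℚ) * T.S.card := by
  simp only [LinearMap.sum_apply, Finset.sum_apply, rt_apply]
  rw [Finset.sum_comm]
  simp only [T.sum_indFun_mul, Finset.sum_const, nsmul_eq_mul]

/-- **Dodson's coefficient count**, general form: for an odd number of translates,
`(Σ_i rt (f i)) 𝟙_{S̃}` and `𝟙_G` are linearly independent. -/
theorem linearIndependent_sumRt_one {ι : Type*} (s : Finset ι) (f : ι → G) (hodd : Odd s.card) :
    LinearIndependent ℚ ![(∑ i ∈ s, rt (f i)) (indFun T.S), fun _ : G => (1 : ℚ)] := by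
  rw [LinearIndependent.pair_iff]
  intro a b hab
  have hsum := congrArg (fun u : G → ℚ => ∑ y : G, u y) hab
  simp only [Pi.add_apply, Pi.smul_apply, smul_eq_mul, Finset.sum_add_distrib, ← Finset.mul_sum,
    Finset.sum_const, Finset.card_univ, nsmul_eq_mul, mul_one, Pi.zero_apply,
    T.sum_sumRt_indFun] at hsum
  have hone := congrFun hab 1
  simp only [Pi.add_apply, Pi.smul_apply, smul_eq_mul, mul_one, Pi.zero_apply,
    T.sumRt_indFun_apply] at hone
  set n₁ := (s.filter fun i => (1 : G) * (f i)⁻¹ ∈ T.S).card with hn₁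
  have hcardG : (Fintype.card G : ℚ) = 2 * T.S.card := by
    rw [← T.two_mul_card_S]; push_cast; ring
  have hS : (T.S.card : ℚ) ≠ 0 := by
    have h := T.two_mul_card_S
    have : 0 < Fintype.card G := Fintype.card_pos
    exact_mod_cast (by omega : T.S.card ≠ 0)
  rw [hcardG] at hsum
  have h1 : a * s.card + 2 * b = 0 := by
    have : (T.S.card : ℚ) * (a * s.card + 2 * b) = 0 := by linear_combination hsum
    exact (mul_eq_zero.mp this).resolve_left hS
  have h2 : a * ((s.card : ℚ) - 2 * n₁) = 0 := by linear_combination h1 - 2 * hone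
  have hodd' : (s.card : ℚ) - 2 * n₁ ≠ 0 := by
    intro h
    have h' : (s.card : ℚ) = 2 * n₁ := by linear_combination h
    have h'' : s.card = 2 * n₁ := by exact_mod_cast h'
    rw [h''] at hodd
    exact (Nat.not_even_iff_odd.mpr hodd) (even_two_mul n₁)
  have ha0 : a = 0 := (mul_eq_zero.mp h2).resolve_right hodd'
  refine ⟨ha0, ?_⟩
  rw [ha0] at hone
  linear_combination hone

end Indep

end CMTriple

end HodgeRepro.Lit2
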